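import Summits.KontsevichZagierPeriods.KontsevichZagierPeriods.Theorems.BetaCancellation.Negative.DirichletLinear

/-!
# `BetaCancellation` (stmt-KontsevichZagierPeriods-13633) — the polar Dirichlet chart (target `stub_dirichletPolar`), PROVED

cdisprove (refuter, gen 2) file for crux #4 `BetaCancellation` of route TerasomaMultiplication
(namespace `…BetaCancellationNegative`, companions `Negative/KernelForm.lean`, `Negative/LoadBearing.lean`).
Sorry-free, axioms ⊆ {propext, Classical.choice, Quot.sound}.

`dirichletPolar` — the chart `Θ(u,v) = (uv, u(1−v))` of the simplex by the box, `|det DΘ| = u`, is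
ONE rule-(2) move; the simplex representation EXISTS: `ℚ`-semialgebraic by
`KZ.isSemialgebraicFunOn_mellinIntegrand` (three factors), absolutely integrable by the chart and
Mathlib's Jacobian criterion `integrableOn_image_iff_integrableOn_abs_det_fderiv_smul` from the
integrability of the GIVEN box representation:
`[box, u^{ℓ+m-1}(1-u)^{-m}v^{ℓ-1}(1-v)^{m-1}] ∼ [simplex, x^{ℓ-1}y^{m-1}(1-x-y)^{-m}]`.
-/

noncomputable section

set_option linter.dupNamespace false

namespace Summit.KontsevichZagierPeriods.KontsevichZagierPeriods.BetaCancellationNegative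

open MeasureTheory Set
open Literature.NumberTheory.Transcendental
open Literature.NumberTheory.Transcendental.KZ
open Literature.ModelTheory.ExponentialFields (IsSemialgebraic isSemialgebraic_univ)
open MvPolynomial (aeval X C)
open Summit.KontsevichZagierPeriods.KontsevichZagierPeriods.Theses.TerasomaMultiplication
  (BetaCancellation)
open Literature.NumberTheory.Transcendental.KZreg (unitIoo isSemialgebraic_unitIoo volume_unitIoo)

/-! ## The polar Dirichlet chart (target `stub_dirichletPolar`) -/

section DirichletCharts

/-! ### The polar chart `Θ(u,v) = (uv, u(1-v))` of the simplex by the box -/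

/-- The polar (Dirichlet) chart `Θ(u, v) = (uv, u(1 - v))`. [folklore] -/
def Θ (z : Fin 2 → ℝ) : Fin 2 → ℝ := ![z 0 * z 1, z 0 * (1 - z 1)]

/-- First component. [folklore] -/
@[simp] theorem Θ_apply_zero (z : Fin 2 → ℝ) : Θ z 0 = z 0 * z 1 := rfl

/-- Second component. [folklore] -/
@[simp] theorem Θ_apply_one (z : Fin 2 → ℝ) : Θ z 1 = z 0 * (1 - z 1) := rfl

/-- The Jacobian matrix of `Θ`. [folklore] -/
def jacΘ (z : Fin 2 → ℝ) : Matrix (Fin 2) (Fin 2) ℝ := !![z 1, z 0; 1 - z 1, -(z 0)]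

/-- The derivative of `Θ`. [folklore] -/
def Θ' (z : Fin 2 → ℝ) : (Fin 2 → ℝ) →L[ℝ] (Fin 2 → ℝ) :=
  LinearMap.toContinuousLinearMap (Matrix.toLin' (jacΘ z))

/-- The derivative applied to a vector, first component. [folklore] -/
@[simp] theorem Θ'_apply_zero (z v : Fin 2 → ℝ) : Θ' z v 0 = z 1 * v 0 + z 0 * v 1 := by
  change Matrix.toLin' (jacΘ z) v 0 = _
  rw [Matrix.toLin'_apply]
  simp [jacΘ, Matrix.mulVec, dotProduct, Fin.sum_univ_two]

/-- The derivative applied to a vector, second component. [folklore] -/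
@[simp] theorem Θ'_apply_one (z v : Fin 2 → ℝ) : Θ' z v 1 = (1 - z 1) * v 0 + -(z 0) * v 1 := by
  change Matrix.toLin' (jacΘ z) v 1 = _
  rw [Matrix.toLin'_apply]
  simp [jacΘ, Matrix.mulVec, dotProduct, Fin.sum_univ_two]

/-- `det DΘ = -u`. [folklore] -/
theorem det_Θ' (z : Fin 2 → ℝ) : (Θ' z).det = -(z 0) := by
  change LinearMap.det (Matrix.toLin' (jacΘ z)) = _
  rw [LinearMap.det_toLin', Matrix.det_fin_two]
  simp [jacΘ]
  ring

/-- `|det DΘ| = u` on the box. [folklore] -/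
theorem abs_det_Θ' {z : Fin 2 → ℝ} (hz : z ∈ box2) : |(Θ' z).det| = z 0 := by
  rw [det_Θ', abs_neg, abs_of_pos hz.1.1]

/-- `Θ` is differentiable with derivative `Θ'`. [folklore] -/
theorem hasFDerivAt_Θ (z : Fin 2 → ℝ) : HasFDerivAt Θ (Θ' z) z := by
  have h0 : HasFDerivAt (fun y : Fin 2 → ℝ => y 0)
      (ContinuousLinearMap.proj (R := ℝ) (φ := fun _ : Fin 2 => ℝ) 0) z := hasFDerivAt_apply 0 z
  have h1 : HasFDerivAt (fun y : Fin 2 → ℝ => y 1)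
      (ContinuousLinearMap.proj (R := ℝ) (φ := fun _ : Fin 2 => ℝ) 1) z := hasFDerivAt_apply 1 z
  rw [hasFDerivAt_pi']
  refine Fin.forall_fin_two.mpr ⟨?_, ?_⟩
  · have hf : (fun y : Fin 2 → ℝ => Θ y 0) = fun y => y 0 * y 1 := funext fun y => rfl
    rw [hf]
    refine (h0.mul h1).congr_fderiv (ContinuousLinearMap.ext fun v => ?_)
    simp
    ring
  · have hf : (fun y : Fin 2 → ℝ => Θ y 1) = fun y => y 0 * (1 - y 1) := funext fun y => rfl
    rw [hf]
    refine (h0.mul (h1.const_sub 1)).congr_fderiv (ContinuousLinearMap.ext fun v => ?_)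
    simp
    ring

/-- `Θ` is injective on the box. [folklore] -/
theorem injOn_Θ : InjOn Θ box2 := by
  intro x hx y hy hxy
  have e0 := congrFun hxy 0
  have e1 := congrFun hxy 1
  simp only [Θ_apply_zero, Θ_apply_one] at e0 e1
  have h0 : x 0 = y 0 := by linarith
  have h1 : x 1 = y 1 := by
    rw [h0] at e0
    exact mul_left_cancel₀ hy.1.1.ne' e0
  funext i
  fin_cases i
  · exact h0
  · exact h1

/-- `Θ` maps the box ONTO the simplex. [folklore] -/
theorem image_Θ_box2 : Θ '' box2 = simplex2 := by
  ext y
  constructor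
  · rintro ⟨z, ⟨h0, h1⟩, rfl⟩
    refine ⟨by simpa using mul_pos h0.1 h1.1, by simpa using mul_pos h0.1 (sub_pos.2 h1.2), ?_⟩
    simp only [Θ_apply_zero, Θ_apply_one]
    nlinarith [h0.2]
  · rintro ⟨hy0, hy1, hy2⟩
    have hs : 0 < y 0 + y 1 := by linarith
    refine ⟨![y 0 + y 1, y 0 / (y 0 + y 1)], ⟨?_, ?_⟩, ?_⟩
    · change y 0 + y 1 ∈ Ioo (0:ℝ) 1
      exact ⟨hs, hy2⟩
    · change y 0 / (y 0 + y 1) ∈ Ioo (0:ℝ) 1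
      exact ⟨div_pos hy0 hs, by rw [div_lt_one hs]; linarith⟩
    · funext i
      fin_cases i
      · change (y 0 + y 1) * (y 0 / (y 0 + y 1)) = y 0
        field_simp
      · change (y 0 + y 1) * (1 - y 0 / (y 0 + y 1)) = y 1
        field_simp
        ring

/-- The substitution polynomials of `Θ`. [folklore] -/
def substΘ : Fin 2 → MvPolynomial (Fin 2) ℚ := ![X 0 * X 1, X 0 * (1 - X 1)]

/-- Evaluating the substitution is the chart. [folklore] -/
theorem aeval_substΘ (z : Fin 2 → ℝ) : (fun i => aeval z (substΘ i)) = Θ z := by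
  funext i
  fin_cases i
  · simp [substΘ]
  · simp [substΘ]

/-- `Θ` is a `ℚ`-semialgebraic map on the box (a polynomial map). [folklore] -/
theorem isSemialgebraicMapOn_Θ : IsSemialgebraicMapOn ℚ box2 Θ := by
  convert isSemialgebraicMapOn_aeval isSemialgebraic_box2 substΘ using 2 with z
  exact (aeval_substΘ z).symm

/-- The simplex kernel `x^{ℓ-1} y^{m-1} (1-x-y)^{-m}`. [folklore] -/
def simplexKernel (ℓ m : ℚ) : (Fin 2 → ℝ) → ℝ :=
  fun z => (z 0) ^ ((ℓ:ℝ) - 1) * (z 1) ^ ((m:ℝ) - 1) * (1 - z 0 - z 1) ^ (-(m:ℝ))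

/-- The simplex kernel is `ℚ`-semialgebraic on the simplex (Euler–Mellin, three factors).
[folklore] -/
theorem isSemialgebraicFunOn_simplexKernel (ℓ m : ℚ) :
    IsSemialgebraicFunOn ℚ simplex2 (simplexKernel ℓ m) := by
  refine (isSemialgebraicFunOn_mellinIntegrand isSemialgebraic_simplex2
    ![MvPolynomial.X 0, MvPolynomial.X 1, 1 - MvPolynomial.X 0 - MvPolynomial.X 1]
    ![ℓ - 1, m - 1, -m] 1 (fun x hx k => ?_)).congr fun x _ => ?_
  · obtain ⟨h0, h1, h2⟩ := hx
    fin_cases k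
    · simpa using h0
    · simpa using h1
    · simp only [Fin.reduceFinMk, Matrix.cons_val, map_sub, map_one, MvPolynomial.aeval_X]
      linarith
  · simp [mellinIntegrand_apply, simplexKernel, Fin.prod_univ_three]

/-- **The pull-back identity of the polar chart**: on the box,
`(x^{ℓ-1} y^{m-1} (1-x-y)^{-m}) ∘ Θ · |det DΘ| = u^{ℓ+m-1}(1-u)^{-m} v^{ℓ-1}(1-v)^{m-1}`. [folklore] -/
theorem pullback_Θ (ℓ m : ℚ) {z : Fin 2 → ℝ} (hz : z ∈ box2) :
    simplexKernel ℓ m (Θ z) * |(Θ' z).det| =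
      (z 0) ^ ((ℓ:ℝ) + m - 1) * (1 - z 0) ^ (-(m:ℝ)) * ((z 1) ^ ((ℓ:ℝ) - 1) * (1 - z 1) ^ ((m:ℝ) - 1)) := by
  have hu0 : 0 < z 0 := hz.1.1
  have hv0 : 0 < z 1 := hz.2.1
  have hv1 : 0 < 1 - z 1 := sub_pos.2 hz.2.2
  rw [abs_det_Θ' hz]
  simp only [simplexKernel, Θ_apply_zero, Θ_apply_one]
  have hfac : 1 - z 0 * z 1 - z 0 * (1 - z 1) = 1 - z 0 := by ring
  rw [hfac, Real.mul_rpow hu0.le hv0.le, Real.mul_rpow hu0.le hv1.le]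
  have key : (z 0) ^ ((ℓ:ℝ) - 1) * (z 0) ^ ((m:ℝ) - 1) * z 0 = (z 0) ^ ((ℓ:ℝ) + m - 1) := by
    rw [← Real.rpow_add hu0, ← Real.rpow_add_one hu0.ne']
    congr 1
    ring
  calc (z 0) ^ ((ℓ:ℝ) - 1) * (z 1) ^ ((ℓ:ℝ) - 1) * ((z 0) ^ ((m:ℝ) - 1) * (1 - z 1) ^ ((m:ℝ) - 1)) *
        (1 - z 0) ^ (-(m:ℝ)) * z 0
      = ((z 0) ^ ((ℓ:ℝ) - 1) * (z 0) ^ ((m:ℝ) - 1) * z 0) * (1 - z 0) ^ (-(m:ℝ)) *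
          ((z 1) ^ ((ℓ:ℝ) - 1) * (1 - z 1) ^ ((m:ℝ) - 1)) := by ring
    _ = _ := by rw [key]

/-- **The lead's `stub_dirichletPolar`, PROVED**: the simplex representation EXISTS (semialgebraic
by Euler–Mellin; integrable by the chart and Mathlib's Jacobian criterion from the integrability of
the given box representation) and the polar chart is ONE rule-(2) move onto it. [folklore] -/
theorem dirichletPolar (ℓ m : ℚ) (hℓ : 0 < ℓ) (hm : 0 < m) (hm1 : m < 1)
    (P : IntegralRep 2)
    (hPd : P.domain = {z | z 0 ∈ Set.Ioo (0:ℝ) 1 ∧ z 1 ∈ Set.Ioo (0:ℝ) 1})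
    (hPi : Set.EqOn P.integrand (fun z => (z 0) ^ ((ℓ:ℝ) + m - 1) * (1 - z 0) ^ (-(m:ℝ)) *
      ((z 1) ^ ((ℓ:ℝ) - 1) * (1 - z 1) ^ ((m:ℝ) - 1))) P.domain) :
    ∃ S : IntegralRep 2,
      S.domain = {z | 0 < z 0 ∧ 0 < z 1 ∧ z 0 + z 1 < 1} ∧
      Set.EqOn S.integrand (fun z => (z 0) ^ ((ℓ:ℝ) - 1) * (z 1) ^ ((m:ℝ) - 1) *
        (1 - z 0 - z 1) ^ (-(m:ℝ))) S.domain ∧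
      Equivalent P S := by
  have _hℓ := hℓ; have _hm := hm; have _hm1 := hm1
  have hPd' : P.domain = box2 := hPd
  -- integrability of the simplex kernel, pulled back through Θ to the given P
  have hbox : IntegrableOn (fun z => |(Θ' z).det| • simplexKernel ℓ m (Θ z)) box2 := by
    have h1 : IntegrableOn P.integrand box2 := hPd' ▸ P.integrableOn
    refine (h1.congr_fun (fun z hz => ?_) measurableSet_box2)
    rw [hPi (by rw [hPd']; exact hz), smul_eq_mul, mul_comm, pullback_Θ ℓ m hz]
  have hint : IntegrableOn (simplexKernel ℓ m) simplex2 := by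
    rw [← image_Θ_box2, integrableOn_image_iff_integrableOn_abs_det_fderiv_smul volume
      measurableSet_box2 (fun x _ => (hasFDerivAt_Θ x).hasFDerivWithinAt) injOn_Θ]
    exact hbox
  let S : IntegralRep 2 := ⟨simplex2, simplexKernel ℓ m, isSemialgebraic_simplex2,
    isSemialgebraicFunOn_simplexKernel ℓ m, hint⟩
  refine ⟨S, rfl, fun _ _ => rfl, ?_⟩
  refine changeOfVariablesRel_subset_relations
    ⟨2, P, S, Θ, Θ', by rw [hPd']; exact isSemialgebraicMapOn_Θ,
      fun x _ => (hasFDerivAt_Θ x).hasFDerivWithinAt, by rw [hPd']; exact injOn_Θ,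
      by rw [hPd', image_Θ_box2], fun z hz => ?_, rfl⟩
  have hz' : z ∈ box2 := by rw [hPd'] at hz; exact hz
  rw [hPi hz]
  show (z 0) ^ ((ℓ:ℝ) + m - 1) * (1 - z 0) ^ (-(m:ℝ)) * ((z 1) ^ ((ℓ:ℝ) - 1) * (1 - z 1) ^ ((m:ℝ) - 1)) =
    simplexKernel ℓ m (Θ z) * |(Θ' z).det|
  rw [pullback_Θ ℓ m hz']

end DirichletCharts

end Summit.KontsevichZagierPeriods.KontsevichZagierPeriods.BetaCancellationNegative
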